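import Mathlib.Algebra.Polynomial.Eval.Defs
import Literature.Computability.Complexity.IteratedAdditionTC0
import Literature.Computability.Complexity.ACVecOver
import Literature.Computability.Complexity.ACRealizeOver
import Literature.Computability.Cryptography.NaorReingoldTC0
import HarnessLib

/-!
# `LiouvilleOrthogonalTC0` (stmt-QuantumAdvantage-1393), line `Sketch` — stub `stub_dilate`

**Dilation closure of `tcBasis`-realizable functions.** There are a constant `D` (`= 10`) and a
polynomial `q ∈ ℕ[X]` such that for every `n, d, s, R` and every `g : {0,1}ⁿ → {0,1}` realized over
`tcBasis` (unbounded fan-in `∧, ∨, ¬` and majority gates, negations free in the depth) at depth `d`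
with `s` gates, the function `x ↦ g (the n low bits of u(x) · R)`, `u(x) = ∑ⱼ xⱼ 2ʲ` (LSB at index
`0`), is realized at depth `d + D` with `s + q(n)` gates — uniformly in `n, d, s, R, g`.

The circuit (Vollmer 1999, §1.4: multiplication by iterated addition, here by a hard-wired
constant): the `n` summands are the hard-wired numbers `2ʲ · (R mod 2ⁿ) < 2²ⁿ` masked by the input
bit `xⱼ` (the bit matrix `(j, t) ↦ xⱼ ∧ bitₜ(2ʲ (R mod 2ⁿ))`, every entry an input literal or the
constant `false`: one layer of depth `1`, `StubDilate.acVecOver_rows`), their sum is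
`u(x) · (R mod 2ⁿ) ≡ u(x) · R (mod 2ⁿ)` (`StubDilate.total_rows`, `StubDilate.testBit_total_rows`,
with the bit bookkeeping `NRTC0.sum_and_testBit_toNat_mul` of the tree's Naor–Reingold circuit,
which adds masked hard-wired numbers in the same way), and its `n` low bits are produced by the
tree's PROVED iterated-addition circuit `ItAdd.acVecOver_iteratedAdd` / `ACVecOver.iteratedAdd`
(`Literature/Computability/Complexity/IteratedAdditionTC0.lean`, depth `9`, size `ItAdd.itAddSize`);
the outer `g` is composed on top by `ACRealOver.compVec` (depths and sizes add). The size
`itAddSize n n + n · 2n` is a polynomial expression with natural coefficients in `n` and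
`ItAdd.R n ≤ 4n² + 4n + 1` (`ItAdd.R_le`), hence monotone in the latter; `q` is that expression
with `R n` replaced by its bound (`StubDilate.exists_sizePoly`).

Theorem-only file, proved from the tree; no named facts are used.
-/

set_option linter.dupNamespace false -- D-0017: single-problem summit ⇒ `QuantumAdvantage.QuantumAdvantage` by design

noncomputable section

namespace Summit.QuantumAdvantage.QuantumAdvantage.Theorems.LiouvilleOrthogonalTC0

open Finset
open Literature.Computability.Complexity
open Literature.Computability.Cryptography (NRTC0.sum_and_testBit_toNat_mul)

namespace StubDilate

/-! ### The summands: shifted copies of `R mod 2ⁿ` masked by the input bits -/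

/-- Every summand fits in `2n` bits: `2ʲ · (R mod 2ⁿ) < 2²ⁿ` for `j < n`. [folklore] -/
theorem shift_lt (n R : ℕ) (j : Fin n) : 2 ^ (j : ℕ) * (R % 2 ^ n) < 2 ^ (n + n) := by
  rw [pow_add]
  exact Nat.mul_lt_mul_of_le_of_lt (Nat.pow_le_pow_right (by norm_num) j.2.le)
    (Nat.mod_lt _ (Nat.two_pow_pos n)) (Nat.two_pow_pos n)

/-- **The sum of the summands.** For the bit matrix `(j, t) ↦ xⱼ ∧ bitₜ(2ʲ (R mod 2ⁿ))` (`n` rows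
of `2n` bits: row `j` is the hard-wired number `2ʲ (R mod 2ⁿ)` if `xⱼ` is set, else `0`), the sum
of the rows is `u(x) · (R mod 2ⁿ)`, `u(x) = ∑ⱼ xⱼ 2ʲ`. [folklore] -/
theorem total_rows (n R : ℕ) (x : Fin n → Bool) :
    ItAdd.total (fun p : Fin n × Fin (n + n) => x p.1 && (2 ^ (p.1 : ℕ) * (R % 2 ^ n)).testBit p.2) =
      (∑ j : Fin n, (x j).toNat * 2 ^ (j : ℕ)) * (R % 2 ^ n) := by
  rw [ItAdd.total_eq, Finset.sum_mul]
  refine Finset.sum_congr rfl fun j _ => ?_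
  show (∑ t : Fin (n + n), (x j && (2 ^ (j : ℕ) * (R % 2 ^ n)).testBit t).toNat * 2 ^ (t : ℕ)) = _
  rw [NRTC0.sum_and_testBit_toNat_mul, Nat.mod_eq_of_lt (shift_lt n R j), mul_assoc]

/-- **The low bits of the sum** are those of `u(x) · R`: both numbers agree modulo `2ⁿ`. [folklore] -/
theorem testBit_total_rows (n R : ℕ) (x : Fin n → Bool) (t : Fin n) :
    (ItAdd.total (fun p : Fin n × Fin (n + n) =>
        x p.1 && (2 ^ (p.1 : ℕ) * (R % 2 ^ n)).testBit p.2)).testBit t =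
      ((∑ j : Fin n, (x j).toNat * 2 ^ (j : ℕ)) * R).testBit t := by
  rw [total_rows]
  have key : ∀ a : ℕ, a.testBit t = (a % 2 ^ n).testBit t := fun a => by
    simp [t.2]
  generalize (∑ j : Fin n, (x j).toNat * 2 ^ (j : ℕ)) = U
  rw [key (U * (R % 2 ^ n)), key (U * R), Nat.mul_mod_mod]

/-! ### The circuit -/

/-- Every entry of the bit matrix is an input literal or the constant `false`: depth `≤ 1`,
`≤ 1` gate. [folklore] -/
theorem acRealOver_rows (n R : ℕ) (p : Fin n × Fin (n + n)) :
    ACRealOver tcBasis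
      (fun x : Fin n → Bool => x p.1 && (2 ^ (p.1 : ℕ) * (R % 2 ^ n)).testBit p.2) 1 1 := by
  -- adapted from `NRTC0.acRealOver_xbitG` (Literature/Computability/Cryptography/NaorReingoldTC0.lean)
  cases hb : (2 ^ (p.1 : ℕ) * (R % 2 ^ n)).testBit p.2
  · exact (acRealOver_const acBasis_subset_tcBasis false).congr fun x => by
      rw [Bool.and_false]
  · exact ((acRealOver_input tcBasis p.1).mono zero_le_one zero_le_one).congr fun x => by
      rw [Bool.and_true]

/-- The bit matrix as one layer of depth `1` with `n · 2n` gates. [folklore] -/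
theorem acVecOver_rows (n R : ℕ) :
    ACVecOver tcBasis (fun (x : Fin n → Bool) (p : Fin n × Fin (n + n)) =>
      x p.1 && (2 ^ (p.1 : ℕ) * (R % 2 ^ n)).testBit p.2) 1
      (Fintype.card (Fin n × Fin (n + n)) * 1) :=
  acVecOver_ofBlocks_fintype_const (κ := Fin n × Fin (n + n))
    (f := fun p x => x p.1 && (2 ^ (p.1 : ℕ) * (R % 2 ^ n)).testBit p.2) (acRealOver_rows n R)

/-- **Multiplication by a constant, low bits**: `x ↦ (bitₜ(u(x) · R))_{t<n}` is realized over
`tcBasis` at depth `10` with `itAddSize n n + n · 2n` gates (iterated addition of the masked shifted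
copies of `R mod 2ⁿ`, Vollmer 1999, Thm. 1.37). [folklore] -/
theorem acVecOver_mulBits (n R : ℕ) :
    ACVecOver tcBasis (fun (x : Fin n → Bool) (t : Fin n) =>
      ((∑ j : Fin n, (x j).toNat * 2 ^ (j : ℕ)) * R).testBit t) (9 + 1)
      (ItAdd.itAddSize n n + Fintype.card (Fin n × Fin (n + n)) * 1) :=
  ((acVecOver_rows n R).iteratedAdd n).congr fun x t => testBit_total_rows n R x t

/-! ### The size polynomial -/

open Polynomial in
/-- **The size bound.** `itAddSize n n + n · 2n` is a polynomial expression with natural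
coefficients in `n` and `ItAdd.R n`, so replacing `ItAdd.R n` by its polynomial bound
`4n² + 4n + 1` (`ItAdd.R_le`) gives a polynomial `q` with `itAddSize n n + n · 2n ≤ q(n)`. [folklore] -/
theorem exists_sizePoly : ∃ q : Polynomial ℕ, ∀ n : ℕ,
    ItAdd.itAddSize n n + Fintype.card (Fin n × Fin (n + n)) * 1 ≤ q.eval n := by
  -- `B` bounds `ItAdd.R n`; the polynomial below is `itAddSize n n + n · 2n` with `R n ↦ B`
  let B : Polynomial ℕ := C 4 * X * X + C 4 * X + C 1
  refine ⟨C 2 * (X * B) * (C 4 * (B + B) + C 11) +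
      X * (C 2 * (C 2 * ((X + C 1) * ((X + C 2) * (B * B * C 1 + C 1) + C 1) + C 1 +
        (B * B * C 1 + C 1) + C 1) + C 1) + C 1) +
      X * (X + X) * C 1, fun n => ?_⟩
  have hR := ItAdd.R_le n
  simp only [B, ItAdd.itAddSize, ItAdd.l1Blk, ItAdd.bitBlk, ItAdd.bBlk, ItAdd.termBlk,
    ItAdd.pairBlk, Fintype.card_prod, Fintype.card_bool, Fintype.card_fin, eval_add, eval_mul,
    eval_X, eval_C]
  gcongr

end StubDilate

/-- **Stub `stub_dilate` (dilation closure).** Multiplying the input (read as a number, LSB at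
index `0`) by a constant `R` and keeping the `n` low bits keeps a function inside the class of
`tcBasis`-realizable functions, at constant extra depth `D = 10` and polynomial extra size `q(n)`,
uniformly in `n, d, s, R, g`: the `n` low bits of `u(x) · R` are the `n` low bits of the sum of the
`n` hard-wired numbers `2ʲ (R mod 2ⁿ)` masked by the input bits `xⱼ`
(`StubDilate.acVecOver_mulBits`: one literal layer, then the tree's iterated addition in `TC⁰`,
`ACVecOver.iteratedAdd`, Vollmer 1999, Thm. 1.37), and `g` is composed on top
(`ACRealOver.compVec`, Vollmer 1999, §1.2). [folklore] -/
theorem stub_dilate :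
    ∃ D : ℕ, ∃ q : Polynomial ℕ, ∀ (n d s R : ℕ) (g : (Fin n → Bool) → Bool),
      ACRealOver tcBasis g d s →
      ACRealOver tcBasis
        (fun x : Fin n → Bool =>
          g (fun i : Fin n => Nat.testBit ((∑ j : Fin n, (x j).toNat * 2 ^ (j : ℕ)) * R) i))
        (d + D) (s + q.eval n) := by
  obtain ⟨q, hq⟩ := StubDilate.exists_sizePoly
  exact ⟨10, q, fun n d s R g hg =>
    (hg.compVec (StubDilate.acVecOver_mulBits n R)).mono (by omega) (Nat.add_le_add_left (hq n) s)⟩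

end Summit.QuantumAdvantage.QuantumAdvantage.Theorems.LiouvilleOrthogonalTC0

end
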